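import Literature.NumberTheory.Automorphic.UnitaryGroupArthurKernelClassExpansion
import Literature.NumberTheory.Automorphic.UnitaryGroupTruncatedKernelHighCusp
import HarnessLib

/-!
# The difference of two class truncated kernels on `U(3)`: `k^{T'}_𝔬(x) − k^{T}_𝔬(x)` is the pseudo-Eisenstein
# series of the class window `1_{T < H ≤ T'} K_{B,𝔬}` (first step of «`J^T_𝔬(f)` is a polynomial in `log T`»)
(Rogawski, *Automorphic Representations of Unitary Groups in Three Variables* (1990), §2.2 p. 13 (the classes
`𝔬̲`, `k^T_𝔬`), §2.3 p. 14; Arthur, *The trace formula in invariant form*, Ann. of Math. 114 (1981), Prop. 2.3: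
every `J^T_𝔬` is a polynomial in `T`)

Topic `NumberTheory/Automorphic`; namespace `Literature.NumberTheory.Automorphic.UnitaryGroup`. THEOREMS ONLY over
accepted tree modules: no definition, no named fact, no instance, no notation, no `sorry`. Piece (3c-a) of the
T1-qs LAW 3 road, item (3c) «per-class polynomial» (cell `pub/hodgecm-mathlib`, crux H413): the class-by-class
copy of ★ `UnitaryGroupTruncatedKernelDifference` (L2-a) in the letters of ★ `UnitaryGroupArthurKernelClassExpansion`
(`cl : G(F) → ι` a class map, `K_{B,𝔬} = kernelBorelClass ν 𝓕 cl i f`, `k^T_𝔬 = truncatedKernelClass ν 𝓕 T cl i f`,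
cut-off tails `kernelBorelTailClass`). The `B(F)`-invariance of the diagonal of `K_{B,𝔬}` enters as the HYPOTHESIS
`hK` (row (C7) of the LAW 3 road discharges it), exactly as in ★ `truncatedKernelClass_rational_mul`; the classes
are unions of conjugacy classes (`hcl : IsConjInvariant cl`).

* §1 `kernelBorelTailClass_sub_kernelBorelTailClass` (`tail_T − tail_{T'} = 1_{T<H≤T'} K_{B,𝔬}`), the class window's
  vanishing/membership lemmas and its left `B(F)`-invariance.
* §2 (`N = 3`) `truncatedKernelClass_eq_kernelClass_sub_of_lt` (`k^T_𝔬(g) = K_𝔬(g,g) − K_{B,𝔬}(g,g)` for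
  `1 ≤ T < H(g)`, from `hK` and the Siegel property ★ `not_lt_borelHeight_mul_of_not_mem_arithmeticBorel`),
  the collapse of the class window's pseudo-Eisenstein series and its `G(F)`-invariance.
* §3 **`truncatedKernelClass_sub_truncatedKernelClass`** — `k^{T'}_𝔬(x) − k^{T}_𝔬(x) =
  Σ_{δ ∈ B(F)\G(F)} 1_{T<H(δx)≤T'} K_{B,𝔬}(δx, δx)` for `1 ≤ T ≤ T'` and every `x`.

## References

* J. D. Rogawski, *Automorphic Representations of Unitary Groups in Three Variables*, Annals of Mathematics
  Studies 123 (1990), §2.2 (p. 13), §2.3 (p. 14) [Rogawski1990].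
* J. Arthur, *The trace formula in invariant form*, Ann. of Math. 114 (1981), Prop. 2.3
  [Arthur1981TraceFormulaInvariantForm].
-/

set_option autoImplicit false

noncomputable section

open MeasureTheory Measure NumberField Set
open scoped NNReal

namespace Literature.NumberTheory.Automorphic

namespace UnitaryGroup

variable {F E : Type} [Field F] [NumberField F] [Field E] [NumberField E] [Algebra F E]
  {c : E ≃ₐ[F] E} {ι : Type*}

/-! ## §1 The class window `1_{T < H ≤ T'} K_{B,𝔬}` as a difference of two cut-off tails -/

section General

variable {N : ℕ} [NeZero N] [MeasurableSpace (adelicUnipotent F E c N)]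

/-- **`1_{T<H(y)} K_{B,𝔬}(y,y) − 1_{T'<H(y)} K_{B,𝔬}(y,y) = 1_{T<H(y)≤T'} K_{B,𝔬}(y,y)`** for `T ≤ T'`.
[cite: Rogawski1990, §2.2 (p. 13)] -/
theorem kernelBorelTailClass_sub_kernelBorelTailClass (ν : Measure (adelicUnipotent F E c N))
    (𝓕 : Set (adelicUnipotent F E c N)) (cl : (quasiSplit F E c N).arithmeticSubgroup → ι) (i : ι)
    (f : (quasiSplit F E c N).Adelic → ℂ) {T T' : ℝ≥0} (hTT' : T ≤ T') (y : (quasiSplit F E c N).Adelic) :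
    kernelBorelTailClass ν 𝓕 T cl i f y - kernelBorelTailClass ν 𝓕 T' cl i f y =
      {y : (quasiSplit F E c N).Adelic | T < borelHeight y ∧ borelHeight y ≤ T'}.indicator
        (fun y => kernelBorelClass ν 𝓕 cl i f y y) y := by
  by_cases h1 : T < borelHeight y
  · by_cases h2 : T' < borelHeight y
    · rw [kernelBorelTailClass_of_lt cl i f h1, kernelBorelTailClass_of_lt cl i f h2, sub_self,
        Set.indicator_of_notMem (fun h => (not_le.2 h2) h.2)]
    · rw [kernelBorelTailClass_of_lt cl i f h1, kernelBorelTailClass_of_not_lt cl i f h2, sub_zero,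
        Set.indicator_of_mem (show y ∈ {y : (quasiSplit F E c N).Adelic |
          T < borelHeight y ∧ borelHeight y ≤ T'} from ⟨h1, not_lt.1 h2⟩)]
  · have h2 : ¬T' < borelHeight y := fun h => h1 (lt_of_le_of_lt hTT' h)
    rw [kernelBorelTailClass_of_not_lt cl i f h1, kernelBorelTailClass_of_not_lt cl i f h2, sub_zero,
      Set.indicator_of_notMem (fun h => h1 h.1)]

/-- The class window vanishes where `¬ T < H(y)`. [cite: Rogawski1990, §2.2 (p. 13)] -/
theorem classWindow_of_not_lt (ν : Measure (adelicUnipotent F E c N)) (𝓕 : Set (adelicUnipotent F E c N))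
    (cl : (quasiSplit F E c N).arithmeticSubgroup → ι) (i : ι) (f : (quasiSplit F E c N).Adelic → ℂ)
    {T T' : ℝ≥0} {y : (quasiSplit F E c N).Adelic} (hy : ¬T < borelHeight y) :
    {y : (quasiSplit F E c N).Adelic | T < borelHeight y ∧ borelHeight y ≤ T'}.indicator
        (fun y => kernelBorelClass ν 𝓕 cl i f y y) y = 0 :=
  Set.indicator_of_notMem (fun h => hy h.1) _

/-- The class window vanishes where `T' < H(y)`. [cite: Rogawski1990, §2.2 (p. 13)] -/
theorem classWindow_of_lt (ν : Measure (adelicUnipotent F E c N)) (𝓕 : Set (adelicUnipotent F E c N))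
    (cl : (quasiSplit F E c N).arithmeticSubgroup → ι) (i : ι) (f : (quasiSplit F E c N).Adelic → ℂ)
    {T T' : ℝ≥0} {y : (quasiSplit F E c N).Adelic} (hy : T' < borelHeight y) :
    {y : (quasiSplit F E c N).Adelic | T < borelHeight y ∧ borelHeight y ≤ T'}.indicator
        (fun y => kernelBorelClass ν 𝓕 cl i f y y) y = 0 :=
  Set.indicator_of_notMem (fun h => (not_le.2 hy) h.2) _

/-- The class window is `K_{B,𝔬}(y,y)` where `T < H(y) ≤ T'`. [cite: Rogawski1990, §2.2 (p. 13)] -/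
theorem classWindow_of_mem (ν : Measure (adelicUnipotent F E c N)) (𝓕 : Set (adelicUnipotent F E c N))
    (cl : (quasiSplit F E c N).arithmeticSubgroup → ι) (i : ι) (f : (quasiSplit F E c N).Adelic → ℂ)
    {T T' : ℝ≥0} {y : (quasiSplit F E c N).Adelic} (h1 : T < borelHeight y) (h2 : borelHeight y ≤ T') :
    {y : (quasiSplit F E c N).Adelic | T < borelHeight y ∧ borelHeight y ≤ T'}.indicator
        (fun y => kernelBorelClass ν 𝓕 cl i f y y) y = kernelBorelClass ν 𝓕 cl i f y y :=
  Set.indicator_of_mem (show y ∈ {y : (quasiSplit F E c N).Adelic |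
    T < borelHeight y ∧ borelHeight y ≤ T'} from ⟨h1, h2⟩) _

/-- **The class window is left `B(F)`-invariant**, granted the `B(F)`-invariance `hK` of the diagonal of `K_{B,𝔬}`
(difference of two invariant tails, ★ `kernelBorelTailClass_rational_borel_mul`). [cite: Rogawski1990, §2.2 (p. 13)] -/
theorem classWindow_rational_borel_mul {ν : Measure (adelicUnipotent F E c N)} {𝓕 : Set (adelicUnipotent F E c N)}
    {cl : (quasiSplit F E c N).arithmeticSubgroup → ι} {i : ι} {f : (quasiSplit F E c N).Adelic → ℂ}
    (hK : ∀ b ∈ arithmeticBorel F E c N, ∀ y : (quasiSplit F E c N).Adelic,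
      kernelBorelClass ν 𝓕 cl i f ((b : (quasiSplit F E c N).Adelic) * y)
        ((b : (quasiSplit F E c N).Adelic) * y) = kernelBorelClass ν 𝓕 cl i f y y)
    {T T' : ℝ≥0} (hTT' : T ≤ T')
    (b : (quasiSplit F E c N).arithmeticSubgroup) (hb : b ∈ arithmeticBorel F E c N)
    (y : (quasiSplit F E c N).Adelic) :
    {y : (quasiSplit F E c N).Adelic | T < borelHeight y ∧ borelHeight y ≤ T'}.indicator
        (fun y => kernelBorelClass ν 𝓕 cl i f y y) ((b : (quasiSplit F E c N).Adelic) * y) =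
      {y : (quasiSplit F E c N).Adelic | T < borelHeight y ∧ borelHeight y ≤ T'}.indicator
        (fun y => kernelBorelClass ν 𝓕 cl i f y y) y := by
  rw [← kernelBorelTailClass_sub_kernelBorelTailClass ν 𝓕 cl i f hTT',
    ← kernelBorelTailClass_sub_kernelBorelTailClass ν 𝓕 cl i f hTT',
    kernelBorelTailClass_rational_borel_mul hK T b hb y, kernelBorelTailClass_rational_borel_mul hK T' b hb y]

end General

/-! ## §2 `N = 3`: high in the cusp, and the collapse of the class window's pseudo-Eisenstein series -/

section Three

variable [MeasurableSpace (adelicUnipotent F E c 3)]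

/-- **`k^T_𝔬(g) = K_𝔬(g,g) − K_{B,𝔬}(g,g)` for `1 ≤ T < H(g)`**, granted `hK`: only `δ = 1` survives in the
pseudo-Eisenstein series of the class tail (Siegel property ★ `not_lt_borelHeight_mul_of_not_mem_arithmeticBorel`).
The class analogue of ★ `truncatedKernel_eq_kernel_sub_kernelBorel`. [cite: Rogawski1990, §2.2 (p. 13)] -/
theorem truncatedKernelClass_eq_kernelClass_sub_of_lt {ν : Measure (adelicUnipotent F E c 3)}
    {𝓕 : Set (adelicUnipotent F E c 3)} {cl : (quasiSplit F E c 3).arithmeticSubgroup → ι} {i : ι}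
    {f : (quasiSplit F E c 3).Adelic → ℂ}
    (hK : ∀ b ∈ arithmeticBorel F E c 3, ∀ y : (quasiSplit F E c 3).Adelic,
      kernelBorelClass ν 𝓕 cl i f ((b : (quasiSplit F E c 3).Adelic) * y)
        ((b : (quasiSplit F E c 3).Adelic) * y) = kernelBorelClass ν 𝓕 cl i f y y)
    {T : ℝ≥0} (hT : 1 ≤ T) {g : (quasiSplit F E c 3).Adelic} (hg : T < borelHeight g) :
    truncatedKernelClass ν 𝓕 T cl i f g = kernelClass cl i f g g - kernelBorelClass ν 𝓕 cl i f g g := by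
  rw [truncatedKernelClass_def,
    pseudoEisenstein_eq_self_of_forall_not_mem (kernelBorelTailClass_rational_borel_mul hK T) g
      (fun _ hγ => kernelBorelTailClass_of_not_lt cl i f (not_lt_borelHeight_mul_of_not_mem_arithmeticBorel hγ hT hg)),
    kernelBorelTailClass_of_lt cl i f hg]

/-- **The class window's pseudo-Eisenstein series at a point high in the cusp**: for `1 ≤ T < H(g)`,
`Σ_δ 1_{T<H(δg)≤T'} K_{B,𝔬}(δg,δg) = 1_{H(g)≤T'} K_{B,𝔬}(g,g)`. [cite: Rogawski1990, §2.2 (p. 13)] -/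
theorem pseudoEisenstein_classWindow_eq_self {ν : Measure (adelicUnipotent F E c 3)}
    {𝓕 : Set (adelicUnipotent F E c 3)} {cl : (quasiSplit F E c 3).arithmeticSubgroup → ι} {i : ι}
    {f : (quasiSplit F E c 3).Adelic → ℂ}
    (hK : ∀ b ∈ arithmeticBorel F E c 3, ∀ y : (quasiSplit F E c 3).Adelic,
      kernelBorelClass ν 𝓕 cl i f ((b : (quasiSplit F E c 3).Adelic) * y)
        ((b : (quasiSplit F E c 3).Adelic) * y) = kernelBorelClass ν 𝓕 cl i f y y)
    {T T' : ℝ≥0} (hT : 1 ≤ T) (hTT' : T ≤ T') {g : (quasiSplit F E c 3).Adelic} (hg : T < borelHeight g) :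
    pseudoEisenstein ({y : (quasiSplit F E c 3).Adelic | T < borelHeight y ∧ borelHeight y ≤ T'}.indicator
        (fun y => kernelBorelClass ν 𝓕 cl i f y y)) g =
      {y : (quasiSplit F E c 3).Adelic | T < borelHeight y ∧ borelHeight y ≤ T'}.indicator
        (fun y => kernelBorelClass ν 𝓕 cl i f y y) g :=
  pseudoEisenstein_eq_self_of_forall_not_mem (classWindow_rational_borel_mul hK hTT') g
    (fun _ hγ => classWindow_of_not_lt ν 𝓕 cl i f (not_lt_borelHeight_mul_of_not_mem_arithmeticBorel hγ hT hg))

/-- **The class window's pseudo-Eisenstein series vanishes below the cusp.** [cite: Rogawski1990, §2.2 (p. 13)] -/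
theorem pseudoEisenstein_classWindow_eq_zero (ν : Measure (adelicUnipotent F E c 3))
    (𝓕 : Set (adelicUnipotent F E c 3)) (cl : (quasiSplit F E c 3).arithmeticSubgroup → ι) (i : ι)
    (f : (quasiSplit F E c 3).Adelic → ℂ) {T T' : ℝ≥0} {x : (quasiSplit F E c 3).Adelic}
    (hx : ∀ γ : (quasiSplit F E c 3).arithmeticSubgroup,
      borelHeight ((γ : (quasiSplit F E c 3).Adelic) * x) ≤ T) :
    pseudoEisenstein ({y : (quasiSplit F E c 3).Adelic | T < borelHeight y ∧ borelHeight y ≤ T'}.indicator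
        (fun y => kernelBorelClass ν 𝓕 cl i f y y)) x = 0 := by
  rw [pseudoEisenstein_def]
  refine finsum_eq_zero_of_forall_eq_zero fun q => ?_
  exact classWindow_of_not_lt ν 𝓕 cl i f (not_lt.2 (hx _))

/-- **The class window's pseudo-Eisenstein series is left `G(F)`-invariant** (★ `pseudoEisenstein_rational_mul`).
[cite: Rogawski1990, §2.2 (p. 13)] -/
theorem pseudoEisenstein_classWindow_rational_mul {ν : Measure (adelicUnipotent F E c 3)}
    {𝓕 : Set (adelicUnipotent F E c 3)} {cl : (quasiSplit F E c 3).arithmeticSubgroup → ι} {i : ι}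
    {f : (quasiSplit F E c 3).Adelic → ℂ}
    (hK : ∀ b ∈ arithmeticBorel F E c 3, ∀ y : (quasiSplit F E c 3).Adelic,
      kernelBorelClass ν 𝓕 cl i f ((b : (quasiSplit F E c 3).Adelic) * y)
        ((b : (quasiSplit F E c 3).Adelic) * y) = kernelBorelClass ν 𝓕 cl i f y y)
    {T T' : ℝ≥0} (hTT' : T ≤ T') (γ : (quasiSplit F E c 3).arithmeticSubgroup) (x : (quasiSplit F E c 3).Adelic) :
    pseudoEisenstein ({y : (quasiSplit F E c 3).Adelic | T < borelHeight y ∧ borelHeight y ≤ T'}.indicator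
        (fun y => kernelBorelClass ν 𝓕 cl i f y y)) ((γ : (quasiSplit F E c 3).Adelic) * x) =
      pseudoEisenstein ({y : (quasiSplit F E c 3).Adelic | T < borelHeight y ∧ borelHeight y ≤ T'}.indicator
        (fun y => kernelBorelClass ν 𝓕 cl i f y y)) x :=
  pseudoEisenstein_rational_mul (classWindow_rational_borel_mul hK hTT') γ x

/-! ## §3 `k^{T'}_𝔬 − k^{T}_𝔬` is the pseudo-Eisenstein series of the class window -/

/-- **At a point with a translate above `T`**: if `1 ≤ T ≤ T'` and `T < H(γ x)` for some `γ ∈ G(F)`, then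
`k^{T'}_𝔬(x) − k^{T}_𝔬(x) = 1_{H(γx) ≤ T'} K_{B,𝔬}(γx, γx)` (move to `g = γ x` by ★ `truncatedKernelClass_rational_mul`).
[cite: Rogawski1990, §2.2 (p. 13)] -/
theorem truncatedKernelClass_sub_truncatedKernelClass_eq_of_lt {ν : Measure (adelicUnipotent F E c 3)}
    {𝓕 : Set (adelicUnipotent F E c 3)} {cl : (quasiSplit F E c 3).arithmeticSubgroup → ι}
    (hcl : IsConjInvariant cl) {i : ι} {f : (quasiSplit F E c 3).Adelic → ℂ}
    (hK : ∀ b ∈ arithmeticBorel F E c 3, ∀ y : (quasiSplit F E c 3).Adelic,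
      kernelBorelClass ν 𝓕 cl i f ((b : (quasiSplit F E c 3).Adelic) * y)
        ((b : (quasiSplit F E c 3).Adelic) * y) = kernelBorelClass ν 𝓕 cl i f y y)
    {T T' : ℝ≥0} (hT : 1 ≤ T) (hTT' : T ≤ T') {x : (quasiSplit F E c 3).Adelic}
    {γ : (quasiSplit F E c 3).arithmeticSubgroup} (hγ : T < borelHeight ((γ : (quasiSplit F E c 3).Adelic) * x)) :
    truncatedKernelClass ν 𝓕 T' cl i f x - truncatedKernelClass ν 𝓕 T cl i f x =
      {y : (quasiSplit F E c 3).Adelic | T < borelHeight y ∧ borelHeight y ≤ T'}.indicator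
        (fun y => kernelBorelClass ν 𝓕 cl i f y y) ((γ : (quasiSplit F E c 3).Adelic) * x) := by
  set g : (quasiSplit F E c 3).Adelic := (γ : (quasiSplit F E c 3).Adelic) * x with hg
  rw [← truncatedKernelClass_rational_mul hcl hK T γ x, ← truncatedKernelClass_rational_mul hcl hK T' γ x, ← hg,
    truncatedKernelClass_eq_kernelClass_sub_of_lt hK hT hγ]
  by_cases h2 : T' < borelHeight g
  · rw [truncatedKernelClass_eq_kernelClass_sub_of_lt hK (hT.trans hTT') h2, sub_self,
      classWindow_of_lt ν 𝓕 cl i f h2]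
  · have hle : ∀ δ : (quasiSplit F E c 3).arithmeticSubgroup,
        borelHeight ((δ : (quasiSplit F E c 3).Adelic) * g) ≤ T' := by
      intro δ
      by_cases hδ : δ ∈ arithmeticBorel F E c 3
      · obtain ⟨γ', hγ'⟩ := δ.2
        have hγ'B : (quasiSplit F E c 3).toAdelic γ' ∈ borelAdelic F E c 3 := by
          rw [hγ']; exact (mem_arithmeticBorel_iff δ).1 hδ
        rw [← hγ', borelHeight_rational_borel_mul γ' hγ'B g]
        exact not_lt.1 h2
      · exact (not_lt.1 (not_lt_borelHeight_mul_of_not_mem_arithmeticBorel hδ hT hγ)).trans hTT'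
    rw [truncatedKernelClass_eq_kernelClass_of_forall_le cl i f hle, sub_sub_cancel,
      classWindow_of_mem ν 𝓕 cl i f hγ (not_lt.1 h2)]

/-- **At a point with no translate above `T`**: `k^{T'}_𝔬(x) − k^{T}_𝔬(x) = 0`. [cite: Rogawski1990, §2.2 (p. 13)] -/
theorem truncatedKernelClass_sub_truncatedKernelClass_eq_zero (ν : Measure (adelicUnipotent F E c 3))
    (𝓕 : Set (adelicUnipotent F E c 3)) (cl : (quasiSplit F E c 3).arithmeticSubgroup → ι) (i : ι)
    (f : (quasiSplit F E c 3).Adelic → ℂ) {T T' : ℝ≥0} (hTT' : T ≤ T') {x : (quasiSplit F E c 3).Adelic}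
    (hx : ∀ γ : (quasiSplit F E c 3).arithmeticSubgroup,
      borelHeight ((γ : (quasiSplit F E c 3).Adelic) * x) ≤ T) :
    truncatedKernelClass ν 𝓕 T' cl i f x - truncatedKernelClass ν 𝓕 T cl i f x = 0 := by
  rw [truncatedKernelClass_eq_kernelClass_of_forall_le cl i f hx,
    truncatedKernelClass_eq_kernelClass_of_forall_le cl i f (fun γ => (hx γ).trans hTT'), sub_self]

/-- **`k^{T'}_𝔬(x) − k^{T}_𝔬(x) = Σ_{δ ∈ B(F)\G(F)} 1_{T < H(δx) ≤ T'} K_{B,𝔬}(δx, δx)`** for `1 ≤ T ≤ T'` and EVERY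
`x ∈ U(J₃)(𝔸_F)`, every class map `cl` whose fibres are unions of conjugacy classes (`hcl`) and every `i`, granted
the `B(F)`-invariance `hK` of the diagonal of `K_{B,𝔬}` (row (C7)) — the class analogue of ★
`truncatedKernel_sub_truncatedKernel`; integrated and unfolded it exhibits `J^{T'}_𝔬(f) − J^{T}_𝔬(f)` as an integral
of `K_{B,𝔬}` over `B(F)\G(𝔸_F) ∩ {T < H ≤ T'}` (Arthur (1981), Prop. 2.3; Rogawski (1990), §2.3).
[cite: Rogawski1990, §2.3 (p. 14)] [cite: Arthur1981TraceFormulaInvariantForm, Prop. 2.3] -/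
theorem truncatedKernelClass_sub_truncatedKernelClass {ν : Measure (adelicUnipotent F E c 3)}
    {𝓕 : Set (adelicUnipotent F E c 3)} {cl : (quasiSplit F E c 3).arithmeticSubgroup → ι}
    (hcl : IsConjInvariant cl) {i : ι} {f : (quasiSplit F E c 3).Adelic → ℂ}
    (hK : ∀ b ∈ arithmeticBorel F E c 3, ∀ y : (quasiSplit F E c 3).Adelic,
      kernelBorelClass ν 𝓕 cl i f ((b : (quasiSplit F E c 3).Adelic) * y)
        ((b : (quasiSplit F E c 3).Adelic) * y) = kernelBorelClass ν 𝓕 cl i f y y)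
    {T T' : ℝ≥0} (hT : 1 ≤ T) (hTT' : T ≤ T') (x : (quasiSplit F E c 3).Adelic) :
    truncatedKernelClass ν 𝓕 T' cl i f x - truncatedKernelClass ν 𝓕 T cl i f x =
      pseudoEisenstein ({y : (quasiSplit F E c 3).Adelic | T < borelHeight y ∧ borelHeight y ≤ T'}.indicator
        (fun y => kernelBorelClass ν 𝓕 cl i f y y)) x := by
  by_cases h : ∃ γ : (quasiSplit F E c 3).arithmeticSubgroup,
      T < borelHeight ((γ : (quasiSplit F E c 3).Adelic) * x)
  · obtain ⟨γ, hγ⟩ := h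
    rw [truncatedKernelClass_sub_truncatedKernelClass_eq_of_lt hcl hK hT hTT' hγ,
      ← pseudoEisenstein_classWindow_rational_mul hK hTT' γ x,
      pseudoEisenstein_classWindow_eq_self hK hT hTT' hγ]
  · simp only [not_exists, not_lt] at h
    rw [truncatedKernelClass_sub_truncatedKernelClass_eq_zero ν 𝓕 cl i f hTT' h,
      pseudoEisenstein_classWindow_eq_zero ν 𝓕 cl i f h]

end Three

end UnitaryGroup

end Literature.NumberTheory.Automorphic
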